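import Summits.ValiantsHypothesis.ValiantsHypothesis.Theorems.KPlusLogSqLawTropicalGradedWalkChainThree
import Summits.ValiantsHypothesis.ValiantsHypothesis.Theorems.KPlusLogSqLawTropicalGradedWalkDomZ

/-!
# Route «KPlusLogSqLaw» — GRW-lite (all-`m` `K = 4` family): the phase-`0` state and the design's own chain `gridS` — `2m² + 1 ≤ B`

HONEST FRAMING.  Helper file `--supports` the crux `Summit.ValiantsHypothesis.ValiantsHypothesis.Theses.KPlusLogSqLaw.TropicalB`
(item `stmt-ValiantsHypothesis-19771`, route `KPlusLogSqLaw`; cell `pub-symmetroid`, seat val-sym-trop-p3 g15, 2026-08-29), on top of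
`…ChainThree` and `…DomZ`.  CENSUS-SIDE (lower-bound) statement about the tropical row `(m, 4)`; nothing about `TropicalB` in its window,
the cell's `K = 4` fork, `WeakLifting`, the doors, `MatrixDescartes` or `VP ≠ VNP`.

CONTENT.  The first state `(0, 0, 0)` of the design (`theta = 0`, the class-`0` diagonal term) is dominant (`isDominant_Z`, zero potentials and
the positivity lemmas `MZ_*`) and its term has the opposite sign of the term of `D(1,0,0)` (`termSign_Z_D`); the design's successor `stepS`
agrees with the chain successor `nxt3` on all chain states (`stepS_eq_nxt3`), so the design's own chain `gridS n 0, …, gridS n (N n)`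
(`…GradedWalkDefs`: `N n = 2(n+1)² + 1`) is `(0,0,0)` followed by the full chain of `…ChainThree` (`gridS_succ_eq`).  Hence
**`TropRootLawAt m 4 B → 2·m² + 1 ≤ B` for every `m ≥ 2`** (`grw4_le_of_tropRootLawAt_four`): the complete GRW-lite design is kernel-verified.
-/

set_option linter.dupNamespace false
set_option autoImplicit false

namespace Summit.ValiantsHypothesis.ValiantsHypothesis.Theorems.LacunarySymmetroidMatrixDescartes.TropicalCensus

namespace GradedWalk

open Summit.ValiantsHypothesis.ValiantsHypothesis.Theorems.MatrixDescartes.Negative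

variable (n : ℕ)

/-! ### the phase-`0` state -/

/-- the permutation of the phase-`0` state is the identity (the rotation of phase `0` is `finRotate ^ (n+1) = 1`). -/
theorem perm_Z : perm n 0 0 0 = 1 := by
  unfold perm; rw [if_pos rfl]
  ext b
  rw [rot_val_wrap n (Nat.zero_le _) b (Nat.zero_le _), Nat.sub_zero]; rfl

/-- the phase-`0` state has class `0` everywhere. -/
theorem lam_Z (b : Fin (n + 1)) : lam n 0 0 0 b = 0 := by
  unfold lam; rw [if_pos (Nat.zero_le _)]

/-- the slope of the phase-`0` state is `0`. -/
theorem theta_Z : theta n 0 0 0 = 0 := by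
  unfold theta; simp

/-- diagonal cell, class `0`: value. -/
theorem ee_dg_zero {a b : Fin (n + 1)} (h : (a : ℕ) = (b : ℕ)) :
    ee n a b 0 = if (b : ℕ) = 0 then zsign n 0 else 1 := by
  unfold ee; rw [if_neg (by omega), if_pos h]; simp

/-- `zsign` is a sign. -/
theorem zsign_ne_zero (b : ℕ) : zsign n b ≠ 0 := by
  unfold zsign; exact pow_ne_zero _ (by norm_num)

/-- `zsign` squares to one. -/
theorem zsign_mul_self (b : ℕ) : zsign n b * zsign n b = 1 := by
  unfold zsign; rw [← pow_add, ← two_mul]; exact Even.neg_one_pow ⟨_, two_mul _⟩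

/-- diagonal cell, class `0`: present. -/
theorem ee_dg_zero_ne {a b : Fin (n + 1)} (h : (a : ℕ) = (b : ℕ)) : ee n a b 0 ≠ 0 := by
  rw [ee_dg_zero n h]; split_ifs
  · exact zsign_ne_zero n 0
  · exact one_ne_zero

/-- **the phase-`0` state `(0, 0, 0)` is dominant at slope `0`.** -/
theorem isDominant_Z : IsDominant (dd n) (vv n) (ee n) (theta n 0 0 0) (cterm n 0 0 0) := by
  rw [theta_Z]
  unfold cterm
  rw [perm_Z]
  refine isDominant_of_scaledPotential (dd n) (vv n) (ee n) 0 1 (lam n 0 0 0) 6 (by norm_num) (fun _ => 0) (fun _ => 0) ?_ ?_ ?_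
  · intro i
    rw [lam_Z, Equiv.Perm.coe_one, id_eq]
    exact ee_dg_zero_ne n rfl
  · intro i
    rw [lam_Z, Equiv.Perm.coe_one, id_eq, vv_diag_zero n rfl]; simp
  · intro a b l hp hne
    rw [lam_Z, Equiv.Perm.coe_one, id_eq] at hne
    show 6 * (0 * ((dd n l : ℕ) : ℤ) - vv n a b l) < 0 + 0
    have han : (a : ℕ) ≤ n := Nat.lt_succ_iff.mp a.isLt
    have hbn : (b : ℕ) ≤ n := Nat.lt_succ_iff.mp b.isLt
    have hl4 : l = 0 ∨ l = 1 ∨ l = 2 ∨ l = 3 := by fin_cases l <;> simp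
    rcases lt_trichotomy (a : ℕ) (b : ℕ) with hab | hab | hba
    · rcases hl4 with rfl | rfl | rfl | rfl
      · have hX : 0 * ((dd n 0 : ℕ) : ℤ) - vv n a b 0 = ((0 : ℤ) - 4 * mZ n * gG n ^ 2 * ((((b : ℕ) - (a : ℕ)) : ℕ) : ℤ) ^ 2) := by
          rw [dd_cast_zero, vv_upper_zero n hab]; push_cast [Nat.cast_sub (le_of_lt hab)]; ring
        rw [hX]; linarith [MZ_up0 n (a : ℕ) (b : ℕ) (by omega) (by omega)]
      · have hX : 0 * ((dd n 1 : ℕ) : ℤ) - vv n a b 1 = ((0 : ℤ) * d1 n - conn n ((b : ℕ) - (a : ℕ)) ((b : ℕ))) := by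
          rw [dd_cast_one, vv_upper_one n hab]
        rw [hX]; linarith [MZ_up1 n (a : ℕ) (b : ℕ) (by omega) (by omega)]
      · exact absurd (ee_upper_ge_two n hab 2 (by decide)) hp
      · exact absurd (ee_upper_ge_two n hab 3 (by decide)) hp
    · rcases hl4 with rfl | rfl | rfl | rfl
      · exfalso; rcases hne with h | h
        · exact h (Fin.ext hab.symm)
        · exact h rfl
      · have hX : 0 * ((dd n 1 : ℕ) : ℤ) - vv n a b 1 = ((0 : ℤ) * d1 n - v1 n (n + 1) ((b : ℕ))) := by
          rw [dd_cast_one, vv_diag n hab 1 (by decide), vblk_one]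
        rw [hX]; linarith [MZ_dg1 n (b : ℕ) (by omega)]
      · have hX : 0 * ((dd n 2 : ℕ) : ℤ) - vv n a b 2 = ((0 : ℤ) * d2 n - (v1 n (n + 1) ((b : ℕ)) + bB n * tau2top n ((b : ℕ)))) := by
          rw [dd_cast_two, vv_diag n hab 2 (by decide), vblk_two, tau2_top]
        rw [hX]; linarith [MZ_dg2 n (b : ℕ) (by omega)]
      · have hX : 0 * ((dd n 3 : ℕ) : ℤ) - vv n a b 3 =
            ((0 : ℤ) * d3 n - ((v1 n (n + 1) ((b : ℕ)) + bB n * tau2top n ((b : ℕ))) + tau3top n ((b : ℕ)))) := by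
          rw [dd_cast_three, vv_diag n hab 3 (by decide), vblk_three, tau2_top, tau3_top]
        rw [hX]; linarith [MZ_dg3 n (b : ℕ) (by omega)]
    · have hE : n + 1 + (b : ℕ) - (a : ℕ) ≠ n + 1 := by omega
      rcases hl4 with rfl | rfl | rfl | rfl
      · exact absurd (ee_lower_zero n hba) hp
      · have hX : 0 * ((dd n 1 : ℕ) : ℤ) - vv n a b 1 = ((0 : ℤ) * d1 n - v1 n (n + 1 + (b : ℕ) - (a : ℕ)) ((b : ℕ))) := by
          rw [dd_cast_one, vv_lower n hba 1, vblk_one]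
        rw [hX]; linarith [MZ_lo1 n (a : ℕ) (b : ℕ) (by omega) (by omega)]
      · have hX : 0 * ((dd n 2 : ℕ) : ℤ) - vv n a b 2 = ((0 : ℤ) * d2 n - (v1 n (n + 1 + (b : ℕ) - (a : ℕ)) ((b : ℕ))
            + bB n * tau2lt n (n + 1 + (b : ℕ) - (a : ℕ)) ((b : ℕ)))) := by
          rw [dd_cast_two, vv_lower n hba 2, vblk_two, tau2_of_ne n hE]
        rw [hX]; linarith [MZ_lo2 n (a : ℕ) (b : ℕ) (by omega) (by omega)]
      · have hX : 0 * ((dd n 3 : ℕ) : ℤ) - vv n a b 3 = ((0 : ℤ) * d3 n - ((v1 n (n + 1 + (b : ℕ) - (a : ℕ)) ((b : ℕ))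
            + bB n * tau2lt n (n + 1 + (b : ℕ) - (a : ℕ)) ((b : ℕ))) + tau3lt n (n + 1 + (b : ℕ) - (a : ℕ)) ((b : ℕ)))) := by
          rw [dd_cast_three, vv_lower n hba 3, vblk_three, tau2_of_ne n hE, tau3_of_ne n hE]
        rw [hX]; linarith [MZ_lo3 n (a : ℕ) (b : ℕ) (by omega) (by omega)]

/-- **`(0,0,0) → D(1,0,0)`**: opposite signs (`1 ≤ n`). -/
theorem termSign_Z_D (hn : 1 ≤ n) :
    termSign (ee n) (cterm n 0 0 0) * termSign (ee n) (cterm n 1 0 0) < 0 := by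
  unfold cterm
  rw [perm_Z, perm_D n (show 0 ≠ 1 by omega), termSign_mul_termSign, Equiv.Perm.sign_one]
  have hr0 : rot n 0 = 1 := by
    have h := perm_Z n
    unfold perm at h; rw [if_pos rfl] at h; exact h
  have hs := sign_rot_mul_sign_rot_succ n 0 (Nat.zero_le _)
  rw [hr0, Equiv.Perm.sign_one, Units.val_one, one_mul, zero_add] at hs
  simp only [Units.val_one, one_mul, Equiv.Perm.coe_one, id_eq]
  rw [hs]
  have h01 : (⟨0, by omega⟩ : Fin (n + 1)) ≠ ⟨1, by omega⟩ := by
    intro h; have := congrArg Fin.val h; simp only at this; omega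
  rw [Finset.prod_eq_mul _ _ h01]
  · have hr0 : ((rot n 1 ⟨0, by omega⟩ : Fin (n + 1)) : ℕ) = 0 + (n + 1 - 1) := rot_val_blk n (by omega) _ (by simp)
    have hr1 : ((rot n 1 ⟨1, by omega⟩ : Fin (n + 1)) : ℕ) = 1 - 1 := rot_val_wrap n (by omega) _ (by simp)
    have hlow : ((⟨0, by omega⟩ : Fin (n + 1)) : ℕ) < ((rot n 1 ⟨0, by omega⟩ : Fin (n + 1)) : ℕ) := by rw [hr0]; simp; omega
    have hup : ((rot n 1 ⟨1, by omega⟩ : Fin (n + 1)) : ℕ) < ((⟨1, by omega⟩ : Fin (n + 1)) : ℕ) := by rw [hr1]; simp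
    rw [lam_Z, lam_Z, lam_D n Nat.zero_lt_one, lam_D n Nat.zero_lt_one, if_neg (by simp), if_neg (by simp), if_pos (by simp),
      ee_dg_zero n rfl, ee_dg_zero n rfl, ee_low_one n hlow, ee_up_zero n hup, hr1]
    simp only [if_true, mul_zero, pow_zero, mul_one, Nat.sub_self]
    have hz := zsign_mul_zsign_succ n 0
    have hstep : zstep n 0 = n + 1 := by unfold zstep; simp
    rw [hstep, zero_add] at hz
    rw [if_neg (show ¬ ((1 : ℕ) = 0) by omega), one_mul, hz, ← pow_add, show n + (n + 1) = 2 * n + 1 by ring,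
      Odd.neg_one_pow ⟨n, rfl⟩]
    norm_num
  · intro b _ hb
    obtain ⟨hb0, hb1⟩ := hb
    have hb0' : (b : ℕ) ≠ 0 := fun h => hb0 (Fin.ext h)
    have hb1' : (b : ℕ) ≠ 1 := fun h => hb1 (Fin.ext h)
    have hr : ((rot n 1 b : Fin (n + 1)) : ℕ) = (b : ℕ) - 1 := rot_val_wrap n (by omega) b (by omega)
    have hup : ((rot n 1 b : Fin (n + 1)) : ℕ) < (b : ℕ) := by rw [hr]; omega
    rw [lam_Z, lam_D n Nat.zero_lt_one, if_pos (show 1 ≤ (b : ℕ) by omega), ee_dg_zero n rfl, if_neg hb0', ee_up_zero n hup, hr,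
      if_neg (by omega), one_mul]
  · intro h; exact absurd (Finset.mem_univ _) h
  · intro h; exact absurd (Finset.mem_univ _) h

/-! ### the design's chain `gridS` is `(0,0,0)` followed by the full chain -/

/-- the design's successor agrees with the chain successor on the chain states. -/
theorem stepS_eq_nxt3 {s : ℕ × ℕ × ℕ} (h : ValidR3 n s) : stepS n s = nxt3 n s := by
  rcases h with ⟨hw, hv⟩ | ⟨hw, hv⟩
  · rw [nxt3_of_le n hw]
    obtain ⟨w, u, t⟩ := s
    dsimp only at hw
    simp only [ValidR2] at hv
    unfold stepS nxt2 cap; dsimp only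
    rw [if_pos (show w < n + 1 by omega)]
    by_cases h1 : u < w
    · rw [if_pos h1, if_pos h1]
      by_cases ht : t = 0
      · subst ht; rw [if_pos rfl]
        by_cases hu0 : u = 0
        · subst hu0; rw [if_neg (by simp), if_pos rfl]
          by_cases h2 : 1 < w
          · rw [if_pos h2]
          · rw [if_neg h2, show w = 1 by omega]
        · rw [if_pos (by rw [Nat.min_def]; split_ifs <;> omega), if_neg hu0]
      · have ht1 : t = 1 := by omega
        subst ht1
        rw [if_neg (by rw [Nat.min_def]; split_ifs <;> omega), if_neg one_ne_zero]
        by_cases h2 : u + 1 < w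
        · rw [if_pos h2]
        · rw [if_neg h2, show u + 1 = w by omega]
    · rw [if_neg h1, if_neg h1]
  · rw [nxt3_of_top n hw]
    obtain ⟨w, u, t⟩ := s
    dsimp only at hw hv
    subst hw
    unfold stepS nxtM cap; dsimp only
    rw [if_neg (lt_irrefl _)]

/-- the design's chain: `gridS n (k+1)` is the `k`-th state of the full chain (`k ≤ lenR3 n`). -/
theorem gridS_succ_eq (k : ℕ) (hk : k ≤ lenR3 n) : gridS n (k + 1) = seqR3 n k := by
  induction k with
  | zero =>
    show stepS n (0, 0, 0) = (1, 0, 0)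
    unfold stepS; simp
  | succ k ih =>
    have h1 : gridS n (k + 1 + 1) = stepS n (gridS n (k + 1)) := by
      unfold gridS; rw [Function.iterate_succ_apply']
    rw [h1, ih (by omega), stepS_eq_nxt3 n (validR3_seqR3 n k (by omega)).1, ← seqR3_succ]

/-- the design's chain starts at the phase-`0` state. -/
theorem gridS_zero : gridS n 0 = (0, 0, 0) := rfl

/-- **the tropical row `(m, 4)`, `m = n + 1 ≥ 2`, is at least `N n = 2m² + 1`**: the design's chain `gridS n 0, …, gridS n (N n)` is a
sign-alternating chain of unique optima at increasing slopes. -/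
theorem N_le_of_tropRootLawAt_four (hn : 1 ≤ n) (B : ℕ) (h : TropRootLawAt (n + 1) 4 B) : lenR3 n + 1 ≤ B := by
  set M := lenR3 n + 1 with hM
  -- the chain as a function of the rank: rank 0 is `(0,0,0)`, rank `j + 1` is `seqR3 n j`
  have hg : ∀ k : ℕ, k ≤ M → gridS n k = (if k = 0 then (0, 0, 0) else seqR3 n (k - 1)) := by
    intro k hk
    rcases Nat.eq_zero_or_pos k with hk0 | hk0
    · subst hk0; rfl
    · obtain ⟨j, rfl⟩ : ∃ j, k = j + 1 := ⟨k - 1, by omega⟩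
      rw [if_neg (by omega), gridS_succ_eq n j (by omega)]; rfl
  exact h (dd n) (vv n) (ee n) M (fun k => theta n (gridS n k).1 (gridS n k).2.1 (gridS n k).2.2)
    (fun k => cterm n (gridS n k).1 (gridS n k).2.1 (gridS n k).2.2)
    (fun i j l => by have := ee_natAbs_lt_two n i j l; omega)
    (by
      refine Fin.strictMono_iff_lt_succ.mpr fun k => ?_
      simp only [Fin.val_castSucc, Fin.val_succ]
      rcases Nat.eq_zero_or_pos (k : ℕ) with hk0 | hk0
      · rw [hk0, gridS_zero, show (0 : ℕ) + 1 = 0 + 1 from rfl, gridS_succ_eq n 0 (Nat.zero_le _), seqR3_zero, theta_Z]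
        dsimp only
        rw [theta_phase_start]; unfold LL; push_cast; nlinarith
      · obtain ⟨j, hj⟩ : ∃ j, (k : ℕ) = j + 1 := ⟨(k : ℕ) - 1, by omega⟩
        rw [hj, gridS_succ_eq n j (by omega), gridS_succ_eq n (j + 1) (by omega), seqR3_succ]
        exact theta_lt_nxt3 n (validR3_seqR3 n j (by omega)).1 (seqR3_ne_last n j (by omega)))
    (fun k => by
      rcases Nat.eq_zero_or_pos (k : ℕ) with hk0 | hk0
      · simp only [hk0, gridS_zero]; exact isDominant_Z n
      · obtain ⟨j, hj⟩ : ∃ j, (k : ℕ) = j + 1 := ⟨(k : ℕ) - 1, by omega⟩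
        simp only [hj, gridS_succ_eq n j (by omega)]
        exact isDominant_validR3 n (validR3_seqR3 n j (by omega)).1)
    (fun k => by
      simp only [Fin.val_castSucc, Fin.val_succ]
      rcases Nat.eq_zero_or_pos (k : ℕ) with hk0 | hk0
      · rw [hk0, gridS_zero, show (0 : ℕ) + 1 = 0 + 1 from rfl, gridS_succ_eq n 0 (Nat.zero_le _), seqR3_zero]
        exact termSign_Z_D n hn
      · obtain ⟨j, hj⟩ : ∃ j, (k : ℕ) = j + 1 := ⟨(k : ℕ) - 1, by omega⟩
        rw [hj, gridS_succ_eq n j (by omega), gridS_succ_eq n (j + 1) (by omega), seqR3_succ]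
        exact termSign_nxt3 n hn (validR3_seqR3 n j (by omega)).1 (seqR3_ne_last n j (by omega)))

end GradedWalk

/-- **The complete GRW-lite floor of the `K = 4` tropical census row.**  Every bound `B` of the tropical row `(m, 4)`, `m ≥ 2`, satisfies
`2·m² + 1 ≤ B`: the design's own chain of `2m² + 2` states — the phase-`0` state, then all phases `1 ≤ w ≤ m` with the deep walks of the
last phase — consists of sign-alternating unique optima at strictly increasing slopes, all kernel-certified.  Census side only; nothing here
bears on `TropicalB` in its window or on the cell's `K = 4` fork. -/
theorem grw4_le_of_tropRootLawAt_four (m B : ℕ) (hm : 2 ≤ m) (h : TropRootLawAt m 4 B) : 2 * m ^ 2 + 1 ≤ B := by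
  obtain ⟨n, rfl⟩ : ∃ n, m = n + 1 := ⟨m - 1, by omega⟩
  have h1 := GradedWalk.N_le_of_tropRootLawAt_four n (by omega) B h
  rw [GradedWalk.lenR3_eq] at h1
  exact h1

end Summit.ValiantsHypothesis.ValiantsHypothesis.Theorems.LacunarySymmetroidMatrixDescartes.TropicalCensus
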